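import Literature.NumberTheory.EllipticCurves.TwoVariableSelmerTower
import Literature.NumberTheory.GaloisRepresentations.AbsGaloisGroupCompact
import Mathlib.Data.Int.GCD
import HarnessLib

/-!
# Prime-to-`p` quotients do not see the `ℤ_p²`-tower: for a closed subgroup `I ≤ Γ_K` and a
# homomorphism `ρ` with `#ρ(I)` prime to `p`, `ρ(I ⊓ Gal(K̄/K̃_∞)) = ρ(I)`

`Proofs` file (theorems only). Typed for the local input at `v̄` of the two-variable → anticyclotomic
control of `H¹_{nr,v̄}(K̃_∞, E[p^∞])` (BSD cell `bsd-ssimc`, crux `AnticyclotomicEisensteinDivisibility`,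
stub `stub_torsionSS`; `TwoVariableAnticyclotomicControlLocalProofs` needs
`E[p^∞]^{Gal(K̄/K̃_∞) ⊓ I_v̄} = 0`, which Serre's Prop. 12 (Invent. Math. 15 (1972)) gives for the FULL
local inertia group `I_v̄`; this file is the passage from `I_v̄` to `I_v̄ ⊓ Gal(K̄/K̃_∞)`).

## The argument (folklore: "the image of inertia has order prime to `p`, and `Gal(K̃_∞/K) ≅ ℤ_p²`
## is pro-`p`")

* `ZpExtension.exists_pow_mul_inv_mem_pairKer_of_coprime` — for a CLOSED subgroup `I ≤ Γ_K`, `N` prime to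
  `p` and `σ ∈ I`, there is `τ ∈ I` with `τ^N σ⁻¹ ∈ pairKer κ₁ κ₂` ("`σ` is an `N`-th power in
  `I / (I ⊓ Gal(K̄/K̃_∞)) ↪ ℤ_p²`"): the sets `S_n = {τ ∈ I : κ_i(τ^N σ⁻¹) ∈ pⁿ ℤ_p}` are closed,
  decreasing and non-empty (`τ = σ^a` with `N a ≡ 1 mod pⁿ`), so they meet, `Γ_K` being compact
  (Cantor; the pattern of `exists_mem_inertia_cyclotomicCharacter_eq` in the tree).
* `ZpExtension.map_inf_pairKer_eq_map_of_coprime` — hence for any homomorphism `ρ : Γ_K → G` whose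
  image of `I` is finite of order prime to `p`: `ρ(I ⊓ pairKer κ₁ κ₂) = ρ(I)`
  (`σ = (τ^N σ⁻¹)⁻¹ τ^N` with `ρ(τ)^N = 1`, `N = #ρ(I)`).
* `ZpExtension.smul_eq_of_forall_inf_pairKer_smul_eq` — so a point fixed by `I ⊓ pairKer` is fixed by
  `I`, when `Γ_K` acts with `#(image of I)` prime to `p`.

Nothing about BSD or elliptic curves is asserted here.

References: J.-P. Serre, Invent. Math. 15 (1972), §1.11 Prop. 12; L. Washington, *Introduction to
Cyclotomic Fields*, §13.1.
-/

noncomputable section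

open scoped Classical

open Field Literature.NumberTheory.GaloisRepresentations

universe u

namespace Literature.NumberTheory.EllipticCurves.ZpExtension

variable {K : Type u} [Field K] {p : ℕ} [Fact p.Prime] (κ₁ κ₂ : ZpExtension K p)

/-- `κ(σ^m σ⁻¹) = (m − 1) κ(σ)` additively. [folklore] -/
private theorem toAdd_map_pow_mul_inv (κ : ZpExtension K p) (σ : absoluteGaloisGroup K) (m : ℕ) :
    (κ (σ ^ m * σ⁻¹)).toAdd = ((m : ℤ_[p]) - 1) * (κ σ).toAdd := by
  rw [map_mul, map_inv, map_pow, toAdd_mul, toAdd_inv, toAdd_pow, nsmul_eq_mul]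
  ring

/-- The level condition `κ(τ) ∈ pⁿ ℤ_p` cuts out a closed subset of `Γ_K` (composed with the continuous
map `τ ↦ τ^N σ⁻¹`). [folklore] -/
private theorem isClosed_setOf_toAdd_map_pow_mul_inv_mem (κ : ZpExtension K p) (σ : absoluteGaloisGroup K)
    (N n : ℕ) :
    IsClosed {τ : absoluteGaloisGroup K |
      (κ (τ ^ N * σ⁻¹)).toAdd ∈ Ideal.span {(p : ℤ_[p]) ^ n}} := by
  have hS : {τ : absoluteGaloisGroup K | (κ (τ ^ N * σ⁻¹)).toAdd ∈ Ideal.span {(p : ℤ_[p]) ^ n}} =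
      (fun τ ↦ ‖(κ (τ ^ N * σ⁻¹)).toAdd‖) ⁻¹' Set.Iic ((p : ℝ) ^ (-(n : ℤ))) := by
    ext τ
    simp only [Set.mem_setOf_eq, Set.mem_preimage, Set.mem_Iic]
    exact (PadicInt.norm_le_pow_iff_mem_span_pow _ n).symm
  rw [hS]
  refine IsClosed.preimage ?_ isClosed_Iic
  have hκ : Continuous fun τ : absoluteGaloisGroup K ↦ κ τ := map_continuous κ.toContinuousMonoidHom
  exact continuous_norm.comp (continuous_toAdd.comp (hκ.comp ((continuous_pow N).mul continuous_const)))

/-- **`σ` is an `N`-th power of an element of `I` modulo `Gal(K̄/K̃_∞)`, for `N` prime to `p`.** For a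
closed subgroup `I ≤ Γ_K`, `N` coprime to `p` and `σ ∈ I` there is `τ ∈ I` with
`τ^N σ⁻¹ ∈ pairKer κ₁ κ₂`. Cantor's intersection theorem in the compact `Γ_K` applied to the closed
non-empty decreasing sets `{τ ∈ I : κ₁(τ^N σ⁻¹), κ₂(τ^N σ⁻¹) ∈ pⁿℤ_p}` (`σ^a` with `N a ≡ 1 (pⁿ)` lies
in the `n`-th one). [cite: Washington1997, §13.1] -/
theorem exists_pow_mul_inv_mem_pairKer_of_coprime {I : Subgroup (absoluteGaloisGroup K)}
    (hI : IsClosed (I : Set (absoluteGaloisGroup K))) {N : ℕ} (hN : N.Coprime p)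
    {σ : absoluteGaloisGroup K} (hσ : σ ∈ I) :
    ∃ τ ∈ I, τ ^ N * σ⁻¹ ∈ pairKer κ₁ κ₂ := by
  have hp : p.Prime := Fact.out
  haveI : CompactSpace (absoluteGaloisGroup K) := absoluteGaloisGroup_compactSpace K
  -- the closed sets
  let S : ℕ → Set (absoluteGaloisGroup K) := fun n ↦
    (I : Set (absoluteGaloisGroup K)) ∩
      ({τ | (κ₁ (τ ^ N * σ⁻¹)).toAdd ∈ Ideal.span {(p : ℤ_[p]) ^ n}} ∩
        {τ | (κ₂ (τ ^ N * σ⁻¹)).toAdd ∈ Ideal.span {(p : ℤ_[p]) ^ n}})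
  have hanti : ∀ n, S (n + 1) ⊆ S n := fun n τ hτ ↦ by
    have hle : Ideal.span {(p : ℤ_[p]) ^ (n + 1)} ≤ Ideal.span {(p : ℤ_[p]) ^ n} :=
      Ideal.span_singleton_le_span_singleton.mpr (pow_dvd_pow _ n.le_succ)
    exact ⟨hτ.1, hle hτ.2.1, hle hτ.2.2⟩
  -- non-empty: `σ^a` with `N a ≡ 1 mod pⁿ`
  have hne : ∀ n, (S n).Nonempty := by
    intro n
    cases n with
    | zero =>
      refine ⟨σ, hσ, ?_, ?_⟩ <;>
        simp only [Set.mem_setOf_eq, pow_zero, Ideal.span_singleton_one, Submodule.mem_top]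
    | succ k =>
      have hk1 : 1 < p ^ (k + 1) := Nat.one_lt_pow (Nat.succ_ne_zero k) hp.one_lt
      obtain ⟨a, -, ha⟩ := Nat.exists_mul_mod_eq_one_of_coprime (hN.pow_right (k + 1)) hk1
      have hq := Nat.div_add_mod (N * a) (p ^ (k + 1))
      rw [ha] at hq
      set q : ℕ := N * a / p ^ (k + 1) with hqdef
      -- `(a N) - 1 = p^(k+1) q` in `ℤ_p`
      have hcast : ((a * N : ℕ) : ℤ_[p]) - 1 = (p : ℤ_[p]) ^ (k + 1) * (q : ℤ_[p]) := by
        have hz : ((a * N : ℕ) : ℤ) - 1 = (p : ℤ) ^ (k + 1) * (q : ℤ) := by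
          have h1 : ((p ^ (k + 1) * q + 1 : ℕ) : ℤ) = ((N * a : ℕ) : ℤ) := by exact_mod_cast hq
          push_cast at h1 ⊢
          linarith
        have h2 := congrArg (Int.cast : ℤ → ℤ_[p]) hz
        push_cast at h2 ⊢
        linear_combination h2
      have hmem : ∀ κ : ZpExtension K p,
          (κ ((σ ^ a) ^ N * σ⁻¹)).toAdd ∈ Ideal.span {(p : ℤ_[p]) ^ (k + 1)} := fun κ ↦ by
        rw [← pow_mul, toAdd_map_pow_mul_inv, hcast, mul_assoc]
        exact Ideal.mul_mem_right _ _ (Ideal.mem_span_singleton_self _)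
      exact ⟨σ ^ a, I.pow_mem hσ a, hmem κ₁, hmem κ₂⟩
  have hclosed : ∀ n, IsClosed (S n) := fun n ↦
    hI.inter ((isClosed_setOf_toAdd_map_pow_mul_inv_mem κ₁ σ N n).inter
      (isClosed_setOf_toAdd_map_pow_mul_inv_mem κ₂ σ N n))
  obtain ⟨τ, hτ⟩ := IsCompact.nonempty_iInter_of_sequence_nonempty_isCompact_isClosed S hanti hne
    (hclosed 0).isCompact hclosed
  refine ⟨τ, (Set.mem_iInter.mp hτ 0).1, ?_⟩
  -- both coordinates of `τ^N σ⁻¹` vanish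
  have hzero : ∀ {x : ℤ_[p]}, (∀ n, x ∈ Ideal.span {(p : ℤ_[p]) ^ n}) → x = 0 := fun {x} hx ↦ by
    refine PadicInt.ext_of_toZModPow.mp fun n ↦ ?_
    rw [map_zero, ← RingHom.mem_ker, PadicInt.ker_toZModPow]
    exact hx n
  rw [mem_pairKer_iff]
  refine ⟨?_, ?_⟩
  · exact toAdd_eq_zero.mp (hzero fun n ↦ (Set.mem_iInter.mp hτ n).2.1)
  · exact toAdd_eq_zero.mp (hzero fun n ↦ (Set.mem_iInter.mp hτ n).2.2)

/-- **Prime-to-`p` images do not see the tower**: for a closed subgroup `I ≤ Γ_K` and a homomorphism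
`ρ : Γ_K → G` such that `ρ(I)` is finite of order prime to `p`, `ρ(I ⊓ pairKer κ₁ κ₂) = ρ(I)`.
(With `N = #ρ(I)`: `σ = (τ^N σ⁻¹)⁻¹ · τ^N`, `ρ(τ)^N = 1`.) [cite: Serre1972, §1.11 Prop. 12 (`#C = p² − 1` prime to `p`)] -/
theorem map_inf_pairKer_eq_map_of_coprime {G : Type*} [Group G]
    (ρ : absoluteGaloisGroup K →* G) {I : Subgroup (absoluteGaloisGroup K)}
    (hI : IsClosed (I : Set (absoluteGaloisGroup K))) [Finite (I.map ρ)]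
    (hcop : (Nat.card (I.map ρ)).Coprime p) :
    (I ⊓ pairKer κ₁ κ₂).map ρ = I.map ρ := by
  refine le_antisymm (Subgroup.map_mono inf_le_left) ?_
  rintro _ ⟨σ, hσ, rfl⟩
  obtain ⟨τ, hτ, hn⟩ := exists_pow_mul_inv_mem_pairKer_of_coprime κ₁ κ₂ hI hcop hσ
  have hnI : τ ^ Nat.card (I.map ρ) * σ⁻¹ ∈ I := I.mul_mem (I.pow_mem hτ _) (I.inv_mem hσ)
  have hpow : ρ τ ^ Nat.card (I.map ρ) = 1 := by
    have h := pow_card_eq_one' (G := I.map ρ) (x := ⟨ρ τ, Subgroup.mem_map_of_mem ρ hτ⟩)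
    exact congrArg Subtype.val h
  have hσeq : σ = (τ ^ Nat.card (I.map ρ) * σ⁻¹)⁻¹ * τ ^ Nat.card (I.map ρ) := by group
  rw [hσeq, map_mul, map_pow, hpow, mul_one]
  exact Subgroup.mem_map_of_mem ρ (Subgroup.inv_mem _ (Subgroup.mem_inf.mpr ⟨hnI, hn⟩))

/-- **A point fixed by `I ⊓ Gal(K̄/K̃_∞)` is fixed by `I`**, for a `Γ_K`-action on a set `X` whose
permutation image of the closed subgroup `I` is finite of order prime to `p`.
[cite: Serre1972, §1.11 Prop. 12] -/
theorem smul_eq_of_forall_inf_pairKer_smul_eq {X : Type*} [MulAction (absoluteGaloisGroup K) X]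
    {I : Subgroup (absoluteGaloisGroup K)} (hI : IsClosed (I : Set (absoluteGaloisGroup K)))
    [Finite (I.map (MulAction.toPermHom (absoluteGaloisGroup K) X))]
    (hcop : (Nat.card (I.map (MulAction.toPermHom (absoluteGaloisGroup K) X))).Coprime p)
    {x : X} (hx : ∀ t ∈ I ⊓ pairKer κ₁ κ₂, t • x = x) : ∀ t ∈ I, t • x = x := by
  intro t ht
  have hmem : MulAction.toPermHom (absoluteGaloisGroup K) X t ∈
      (I ⊓ pairKer κ₁ κ₂).map (MulAction.toPermHom (absoluteGaloisGroup K) X) := by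
    rw [map_inf_pairKer_eq_map_of_coprime κ₁ κ₂ _ hI hcop]
    exact Subgroup.mem_map_of_mem _ ht
  obtain ⟨s, hs, hst⟩ := Subgroup.mem_map.mp hmem
  have h := congrArg (fun f : Equiv.Perm X ↦ f x) hst
  simp only [MulAction.toPermHom_apply, MulAction.toPerm_apply] at h
  rw [← h]
  exact hx s hs

end Literature.NumberTheory.EllipticCurves.ZpExtension

end
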